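import Summits.KontsevichZagierPeriods.KontsevichZagierPeriods.Theorems.UnfoldedStokesStokesGenerationFibrewiseRungSaAngSwap

/-!
# `StokesGeneration` (stmt-KontsevichZagierPeriods-3586), line `fibrewise_stokes` — THEOREM D′: separated variables below genus one

Crux `Summit.KontsevichZagierPeriods.KontsevichZagierPeriods.Theses.UnfoldedStokes.StokesGeneration`; residual stub S2
`stub_fibrewiseStokesGeneration`. THEOREM D′ (`fibStokesDecomposable_saSeparated`) is the semialgebraic-C¹ strengthening of THEOREM D
(`fibStokesDecomposable_separatedRat`, p132794): on a closed unit cube `[0,1]^N`, every value-zero integrand which is a finite sum of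
SEPARATED one-variable atoms of the three kinds below genus one —
* exact atoms `g₀(x_a)` with a ℚ-semialgebraic C¹ primitive `G₀` on `[0,1]`,
* logarithmic atoms `c · f′(x_b)/f(x_b)` (`c` algebraic, `f > 0` ℚ-semialgebraic C¹),
* angular atoms `d · (A B′ − A′ B)/(A² + B²)(x_e)` (`d` algebraic, `(A,B)` a ℚ-semialgebraic C¹ loop avoiding the origin),
is fibrewise-Stokes decomposable, i.e. lies in the span of S2's fibrewise Newton–Leibniz relators. The proof transposes every atom to a
home coordinate (`fibStokesDecomposable_saDlogSwap` p133166, `fibStokesDecomposable_saAngSwap`, exact atoms by the closure algebra),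
and concludes with the one-coordinate mixed Baker layer (`fibStokesDecomposable_saDimOneMixed`, p133954), the value hypothesis being
transported along (`stub_saMixedValue`, `stub_valueOneCoord`).

References: M. Kontsevich, D. Zagier, *Periods* (2001), §1.2 and Conjecture 1; A. Baker, *Transcendental Number Theory* (1975) Thm 2.1
(through `stub_rungMixedBaker`).
-/

noncomputable section

set_option linter.dupNamespace false

namespace Summit.KontsevichZagierPeriods.KontsevichZagierPeriods.Cruxes.StokesGeneration.FibrewiseStokes

open MeasureTheory Set
open Literature.NumberTheory.Transcendental
open Literature.NumberTheory.Transcendental.KZ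
open Literature.ModelTheory.ExponentialFields (IsSemialgebraic)

/-! ## THEOREM D′: separated variables with semialgebraic logarithmic atoms -/

/-- **S2 on the whole separated-variables layer below genus one (THEOREM D′; lead c5).** A closed-cube representation on `[0,1]^N`
whose integrand is a sum of ONE-COORDINATE logarithmic atoms with `ℚ`-semialgebraic `C¹` data — exact atoms `g₀ₑ(x_{aₑ})`
(`G₀ₑ′ = g₀ₑ`), dlog atoms `cᵢ fᵢ′(x_{bᵢ})/fᵢ(x_{bᵢ})` (`fᵢ > 0`) and angular atoms `dₖ ωₖ(x_{eₖ})`, `ωₖ = (Aₖ Bₖ′ − Aₖ′ Bₖ)/(Aₖ² + Bₖ²)`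
(`Aₖ² + Bₖ² > 0`), algebraic `cᵢ, dₖ` — and value `0` is fibrewise-Stokes decomposable: every atom is transposed to a home coordinate
(exact `stub_exactSwap`, dlog rung 10d, angular rung 10e; placed by `stub_placeCoords`; transpositions integrate to `0` and need no value
hypothesis), and the remainder is ONE mixed form of the home coordinate whose value is the total value (Fubini on the unit cube), decomposable
by rung 10c. Genuinely `N`-dimensional; Baker-complete below genus one. [cite: KontsevichZagier2001, §1.2 Conjecture 1] -/
theorem fibStokesDecomposable_saSeparated {N : ℕ} (n₀ : ℕ) (G₀ g₀ : Fin n₀ → ℝ → ℝ) (a : Fin n₀ → Fin N)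
    (n₁ : ℕ) (c : Fin n₁ → ℝ) (f f' : Fin n₁ → ℝ → ℝ) (b : Fin n₁ → Fin N)
    (n₂ : ℕ) (d : Fin n₂ → ℝ) (A B A' B' : Fin n₂ → ℝ → ℝ) (e : Fin n₂ → Fin N)
    (hG₀ : ∀ l, IsSemialgebraicFunOn ℚ (Set.pi Set.univ (fun _ : Fin 1 => Set.Icc (0:ℝ) 1)) (fun z => G₀ l (z 0))) (hg₀ : ∀ l, IsSemialgebraicFunOn ℚ (Set.pi Set.univ (fun _ : Fin 1 => Set.Icc (0:ℝ) 1)) (fun z => g₀ l (z 0)))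
    (hG₀c : ∀ l, ContinuousOn (G₀ l) (Set.Icc (0:ℝ) 1)) (hg₀c : ∀ l, ContinuousOn (g₀ l) (Set.Icc (0:ℝ) 1))
    (hG₀d : ∀ l, ∀ u ∈ Set.Icc (0:ℝ) 1, HasDerivAt (G₀ l) (g₀ l u) u)
    (hc : ∀ i, IsAlgebraic ℚ (c i))
    (hf : ∀ i, IsSemialgebraicFunOn ℚ (Set.pi Set.univ (fun _ : Fin 1 => Set.Icc (0:ℝ) 1)) (fun z => f i (z 0))) (hf' : ∀ i, IsSemialgebraicFunOn ℚ (Set.pi Set.univ (fun _ : Fin 1 => Set.Icc (0:ℝ) 1)) (fun z => f' i (z 0)))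
    (hfpos : ∀ i, ∀ u ∈ Set.Icc (0:ℝ) 1, 0 < f i u) (hfc : ∀ i, ContinuousOn (f i) (Set.Icc (0:ℝ) 1))
    (hf'c : ∀ i, ContinuousOn (f' i) (Set.Icc (0:ℝ) 1)) (hfd : ∀ i, ∀ u ∈ Set.Ioo (0:ℝ) 1, HasDerivAt (f i) (f' i u) u)
    (hd : ∀ k, IsAlgebraic ℚ (d k))
    (hA : ∀ k, IsSemialgebraicFunOn ℚ (Set.pi Set.univ (fun _ : Fin 1 => Set.Icc (0:ℝ) 1)) (fun z => A k (z 0))) (hB : ∀ k, IsSemialgebraicFunOn ℚ (Set.pi Set.univ (fun _ : Fin 1 => Set.Icc (0:ℝ) 1)) (fun z => B k (z 0)))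
    (hA' : ∀ k, IsSemialgebraicFunOn ℚ (Set.pi Set.univ (fun _ : Fin 1 => Set.Icc (0:ℝ) 1)) (fun z => A' k (z 0))) (hB' : ∀ k, IsSemialgebraicFunOn ℚ (Set.pi Set.univ (fun _ : Fin 1 => Set.Icc (0:ℝ) 1)) (fun z => B' k (z 0)))
    (hAc : ∀ k, ContinuousOn (A k) (Set.Icc (0:ℝ) 1)) (hBc : ∀ k, ContinuousOn (B k) (Set.Icc (0:ℝ) 1))
    (hA'c : ∀ k, ContinuousOn (A' k) (Set.Icc (0:ℝ) 1)) (hB'c : ∀ k, ContinuousOn (B' k) (Set.Icc (0:ℝ) 1))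
    (hAd : ∀ k, ∀ u ∈ Set.Ioo (0:ℝ) 1, HasDerivAt (A k) (A' k u) u) (hBd : ∀ k, ∀ u ∈ Set.Ioo (0:ℝ) 1, HasDerivAt (B k) (B' k u) u)
    (hAB : ∀ k, ∀ u ∈ Set.Icc (0:ℝ) 1, A k u ^ 2 + B k u ^ 2 ≠ 0)
    (home : Fin N)
    (t : IntegralRep N) (ht : t.domain = Set.pi Set.univ (fun _ : Fin N => Set.Icc (0:ℝ) 1))
    (hti : ∀ x ∈ Set.pi Set.univ (fun _ : Fin N => Set.Icc (0:ℝ) 1), t.integrand x =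
      ∑ l, g₀ l (x (a l)) + ∑ i, c i * (f' i (x (b i)) / f i (x (b i))) +
        ∑ k, d k * ((A k (x (e k)) * B' k (x (e k)) - A' k (x (e k)) * B k (x (e k))) /
          (A k (x (e k)) ^ 2 + B k (x (e k)) ^ 2)))
    (hv : t.value = 0) : FibStokesDecomposable N t.integrand := by
  classical
  have hS1 := isSemialgebraic_cubePi_one
  -- the atoms as functions of one variable
  set dl : Fin n₁ → ℝ → ℝ := fun i u => f' i u / f i u with hdl
  set ω : Fin n₂ → ℝ → ℝ := fun k u => (A k u * B' k u - A' k u * B k u) / (A k u ^ 2 + B k u ^ 2) with hω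
  have hdlc : ∀ i, ContinuousOn (dl i) (Set.Icc (0:ℝ) 1) := fun i => (hf'c i).div (hfc i) fun u hu => (hfpos i u hu).ne'
  have hωc : ∀ k, ContinuousOn (ω k) (Set.Icc (0:ℝ) 1) := fun k =>
    saLoopAngle_integrand_continuousOn (hAc k) (hBc k) (hA'c k) (hB'c k) (hAB k)
  -- placing a two-variable transposition at `(p, home)`
  have hplace : ∀ (κ : ℝ → ℝ) (p : Fin N), FibStokesDecomposable 2 (fun z => κ (z 0) - κ (z 1)) →
      FibStokesDecomposable N (fun x => κ (x p) - κ (x home)) := by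
    intro κ p h2
    by_cases hp : p = home
    · refine fibStokesDecomposable_congr_off_null N _ _ ∅ Literature.ModelTheory.ExponentialFields.isSemialgebraic_empty
        measure_empty (fun x _ _ => ?_) (fibStokesDecomposable_zero N)
      simp [hp]
    · have hinj : Function.Injective (![p, home] : Fin 2 → Fin N) := by
        intro i j hij
        fin_cases i <;> fin_cases j
        · rfl
        · simp at hij; exact absurd hij hp
        · simp at hij; exact absurd hij.symm hp
        · rfl
      have := stub_placeCoords 2 _ h2 N ![p, home] hinj
      simpa using this
  -- the three kinds of transpositions
  have hTe : ∀ l, FibStokesDecomposable N (fun x => g₀ l (x (a l)) - g₀ l (x home)) := fun l =>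
    hplace (g₀ l) (a l) (stub_exactSwap (G₀ l) (g₀ l) (hG₀ l) (hg₀ l) (hG₀c l) (hg₀c l)
      fun u hu => hG₀d l u (Set.Ioo_subset_Icc_self hu))
  have hTd : ∀ i, FibStokesDecomposable N (fun x => c i * dl i (x (b i)) - c i * dl i (x home)) := fun i =>
    hplace (fun u => c i * dl i u) (b i) (by
      have := fibStokesDecomposable_saDlogSwap (c i) (f i) (f i) (f' i) (f' i) (hc i) (hf i) (hf i) (hf' i) (hf' i)
        (hfc i) (hfc i) (hf'c i) (hf'c i) (hfd i) (hfd i) (hfpos i) (hfpos i) (mul_comm _ _)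
      simpa only [hdl, mul_sub] using this)
  have hTa : ∀ k, FibStokesDecomposable N (fun x => d k * ω k (x (e k)) - d k * ω k (x home)) := fun k =>
    hplace (fun u => d k * ω k u) (e k) (by
      have := fibStokesDecomposable_saAngSwap (d k) (A k) (B k) (A' k) (B' k) (hd k) (hA k) (hB k) (hA' k) (hB' k)
        (hAc k) (hBc k) (hA'c k) (hB'c k) (hAd k) (hBd k) (hAB k)
      simpa only [hω, mul_sub] using this)
  -- the remainder at the home coordinate: one mixed form of one variable
  set H : ℝ → ℝ := fun u => (∑ l, g₀ l u) + ∑ i, c i * dl i u + ∑ k, d k * ω k u with hH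
  have hHsa : IsSemialgebraicFunOn ℚ (Set.pi Set.univ (fun _ : Fin 1 => Set.Icc (0:ℝ) 1)) (fun z => H (z 0)) :=
    ((IsSemialgebraicFunOn.fun_finsetSum _ hS1 fun l _ => hg₀ l).fun_add
      (IsSemialgebraicFunOn.fun_finsetSum _ hS1 fun i _ => (isSemialgebraicFunOn_const_of_isAlgebraic hS1 (hc i)).fun_mul
        ((hf' i).div (hf i) fun z hz => (hfpos i (z 0) (hz 0 (Set.mem_univ _))).ne'))).fun_add
      (IsSemialgebraicFunOn.fun_finsetSum _ hS1 fun k _ => (isSemialgebraicFunOn_const_of_isAlgebraic hS1 (hd k)).fun_mul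
        ((((hA k).fun_mul (hB' k)).fun_sub ((hA' k).fun_mul (hB k))).div (((hA k).fun_pow 2).fun_add ((hB k).fun_pow 2))
          fun z hz => hAB k (z 0) (hz 0 (Set.mem_univ _))))
  have hHc : ContinuousOn H (Set.Icc (0:ℝ) 1) :=
    ((continuousOn_finsetSum _ fun l _ => hg₀c l).add
      (continuousOn_finsetSum _ fun i _ => continuousOn_const.mul (hdlc i))).add
      (continuousOn_finsetSum _ fun k _ => continuousOn_const.mul (hωc k))
  obtain ⟨t₀, ht₀, ht₀i⟩ := exists_cubeRep_one H hHsa hHc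
  -- its value is the value of `t`
  have hmeas : MeasurableSet (Set.pi Set.univ (fun _ : Fin N => Set.Icc (0:ℝ) 1)) :=
    MeasurableSet.univ_pi fun _ => measurableSet_Icc
  have hK : IsCompact (Set.pi Set.univ (fun _ : Fin N => Set.Icc (0:ℝ) 1)) := isCompact_univ_pi fun _ => isCompact_Icc
  have hint1 : ∀ (κ : ℝ → ℝ) (p : Fin N), ContinuousOn κ (Set.Icc (0:ℝ) 1) →
      IntegrableOn (fun x : Fin N → ℝ => κ (x p)) (Set.pi Set.univ (fun _ : Fin N => Set.Icc (0:ℝ) 1)) :=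
    fun κ p hκ => (hκ.comp (continuous_apply p).continuousOn
      fun x (hx : x ∈ Set.pi Set.univ (fun _ : Fin N => Set.Icc (0:ℝ) 1)) => hx p (Set.mem_univ _)).integrableOn_compact hK
  set F : (Fin N → ℝ) → ℝ := fun x => ∑ l, g₀ l (x (a l)) with hF
  set G : (Fin N → ℝ) → ℝ := fun x => ∑ i, c i * dl i (x (b i)) with hG
  set Kf : (Fin N → ℝ) → ℝ := fun x => ∑ k, d k * ω k (x (e k)) with hKf
  have hti2 : ∀ x ∈ Set.pi Set.univ (fun _ : Fin N => Set.Icc (0:ℝ) 1), t.integrand x = F x + G x + Kf x :=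
    fun x hx => by rw [hti x hx]
  have hFi : IntegrableOn F (Set.pi Set.univ (fun _ : Fin N => Set.Icc (0:ℝ) 1)) :=
    integrable_finsetSum _ fun l _ => hint1 (g₀ l) (a l) (hg₀c l)
  have hGi : IntegrableOn G (Set.pi Set.univ (fun _ : Fin N => Set.Icc (0:ℝ) 1)) :=
    integrable_finsetSum _ fun i _ => hint1 (fun u => c i * dl i u) (b i) (continuousOn_const.mul (hdlc i))
  have hKi : IntegrableOn Kf (Set.pi Set.univ (fun _ : Fin N => Set.Icc (0:ℝ) 1)) :=
    integrable_finsetSum _ fun k _ => hint1 (fun u => d k * ω k u) (e k) (continuousOn_const.mul (hωc k))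
  have hFv : ∫ x in Set.pi Set.univ (fun _ : Fin N => Set.Icc (0:ℝ) 1), F x = ∑ l, ∫ u in (0:ℝ)..1, g₀ l u := by
    simp only [hF]
    rw [integral_finsetSum _ fun l _ => hint1 (g₀ l) (a l) (hg₀c l)]
    exact Finset.sum_congr rfl fun l _ => setIntegral_cubePi_comp_eval_eq_intervalIntegral (a l) (hg₀c l)
  have hGv : ∫ x in Set.pi Set.univ (fun _ : Fin N => Set.Icc (0:ℝ) 1), G x = ∑ i, ∫ u in (0:ℝ)..1, c i * dl i u := by
    simp only [hG]
    rw [integral_finsetSum _ fun i _ => hint1 (fun u => c i * dl i u) (b i) (continuousOn_const.mul (hdlc i))]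
    exact Finset.sum_congr rfl fun i _ =>
      setIntegral_cubePi_comp_eval_eq_intervalIntegral (g := fun u => c i * dl i u) (b i) (continuousOn_const.mul (hdlc i))
  have hKv : ∫ x in Set.pi Set.univ (fun _ : Fin N => Set.Icc (0:ℝ) 1), Kf x = ∑ k, ∫ u in (0:ℝ)..1, d k * ω k u := by
    simp only [hKf]
    rw [integral_finsetSum _ fun k _ => hint1 (fun u => d k * ω k u) (e k) (continuousOn_const.mul (hωc k))]
    exact Finset.sum_congr rfl fun k _ =>
      setIntegral_cubePi_comp_eval_eq_intervalIntegral (g := fun u => d k * ω k u) (e k) (continuousOn_const.mul (hωc k))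
  have htval : t.value = (∑ l, ∫ u in (0:ℝ)..1, g₀ l u) + ∑ i, (∫ u in (0:ℝ)..1, c i * dl i u) +
      ∑ k, ∫ u in (0:ℝ)..1, d k * ω k u := by
    have e1 := integral_add (hFi.add hGi) hKi
    have e2 := integral_add hFi hGi
    simp only [Pi.add_apply] at e1 e2
    rw [IntegralRep.value, ht, setIntegral_congr_fun hmeas hti2, e1, e2, hFv, hGv, hKv]
  -- the same three interval integrals compute the value of `t₀`
  set F₁ : ℝ → ℝ := fun u => ∑ l, g₀ l u with hF₁
  set G₁ : ℝ → ℝ := fun u => ∑ i, c i * dl i u with hG₁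
  set K₁ : ℝ → ℝ := fun u => ∑ k, d k * ω k u with hK₁
  have hF₁c : ContinuousOn F₁ (Set.Icc (0:ℝ) 1) := continuousOn_finsetSum _ fun l _ => hg₀c l
  have hG₁c : ContinuousOn G₁ (Set.Icc (0:ℝ) 1) := continuousOn_finsetSum _ fun i _ => continuousOn_const.mul (hdlc i)
  have hK₁c : ContinuousOn K₁ (Set.Icc (0:ℝ) 1) := continuousOn_finsetSum _ fun k _ => continuousOn_const.mul (hωc k)
  have hHi : ∀ u ∈ Set.uIcc (0:ℝ) 1, H u = F₁ u + G₁ u + K₁ u := fun u _ => rfl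
  have ht₀v : t₀.value = 0 := by
    rw [value_cubeRep_one_eq_intervalIntegral t₀ H ht₀ (fun z _ => by rw [ht₀i]), intervalIntegral.integral_congr hHi,
      intervalIntegral.integral_add ((hF₁c.intervalIntegrable_of_Icc zero_le_one).add
        (hG₁c.intervalIntegrable_of_Icc zero_le_one)) (hK₁c.intervalIntegrable_of_Icc zero_le_one),
      intervalIntegral.integral_add (hF₁c.intervalIntegrable_of_Icc zero_le_one) (hG₁c.intervalIntegrable_of_Icc zero_le_one)]
    simp only [hF₁, hG₁, hK₁]
    rw [intervalIntegral.integral_finsetSum (fun l _ => (hg₀c l).intervalIntegrable_of_Icc zero_le_one),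
      intervalIntegral.integral_finsetSum (fun i _ => ((hdlc i).intervalIntegrable_of_Icc zero_le_one).const_mul _),
      intervalIntegral.integral_finsetSum (fun k _ => ((hωc k).intervalIntegrable_of_Icc zero_le_one).const_mul _),
      ← htval, hv]
  have hdec₀ : FibStokesDecomposable 1 t₀.integrand :=
    fibStokesDecomposable_saDimOneMixed n₁ f f' c n₂ A B A' B' d (fun u => ∑ l, G₀ l u) (fun u => ∑ l, g₀ l u)
      hf hf' hc hfpos hfc hf'c hfd hA hB hA' hB' hAc hBc hA'c hB'c hAd hBd hd hAB
      (IsSemialgebraicFunOn.fun_finsetSum _ hS1 fun l _ => hG₀ l) (IsSemialgebraicFunOn.fun_finsetSum _ hS1 fun l _ => hg₀ l)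
      (fun u hu => HasDerivAt.fun_sum fun l _ => hG₀d l u hu) (continuousOn_finsetSum _ fun l _ => hg₀c l)
      t₀ ht₀ (fun z _ => by rw [ht₀i]) ht₀v
  have hplace₀ : FibStokesDecomposable N (fun x => H (x home)) := by
    have := stub_placeCoords 1 _ hdec₀ N (fun _ => home) (fun p q _ => Subsingleton.elim p q)
    simpa [ht₀i] using this
  -- assemble
  have hsum := fibStokesDecomposable_add N _ _
    (fibStokesDecomposable_add N _ _
      (fibStokesDecomposable_add N _ _ (fibStokesDecomposable_finsetSum Finset.univ _ fun l _ => hTe l)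
        (fibStokesDecomposable_finsetSum Finset.univ _ fun i _ => hTd i))
      (fibStokesDecomposable_finsetSum Finset.univ _ fun k _ => hTa k)) hplace₀
  refine fibStokesDecomposable_congr_off_null N _ _ ∅ Literature.ModelTheory.ExponentialFields.isSemialgebraic_empty
    measure_empty (fun x hx _ => ?_) hsum
  rw [hti x hx]
  simp only [hH, hdl, hω, Finset.sum_sub_distrib]
  ring

end Summit.KontsevichZagierPeriods.KontsevichZagierPeriods.Cruxes.StokesGeneration.FibrewiseStokes

end
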